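import Summits.HubbardSuperconductivity.HubbardSuperconductivity.Theorems.LevyLogBootstrapDressHalfFilledStubPlaquetteDictionary
import Summits.HubbardSuperconductivity.HubbardSuperconductivity.Theses.AnisotropyChord
import Literature.MathematicalPhysics.QuantumLattice.SpinChainsLiebMattisProofs
import Literature.MathematicalPhysics.QuantumLattice.AndersonTowerOfStates
import Literature.MathematicalPhysics.QuantumLattice.HardCoreBosonHalfFillingOptimal
import Literature.MathematicalPhysics.QuantumLattice.XYOrderDischarges
import HarnessLib

/-!
# Crux `DressHalfFilled` (stmt-HubbardSuperconductivity-8148, routes `AnisotropyChord` / `LevyLogBootstrap`), stub 3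
# `stub_dressHalfFilled`: the ZEROTH-ORDER DRESSING INEQUALITY — the plaquette-boson dictionary transports planar
# order into `d`-wave pair-field order at `t' = 0`

Helper file (`--supports stmt-HubbardSuperconductivity-8148`). Notation: `Φ` the dictionary isometry of
`PlaquetteDictionary U` (side `L = 2M`, `8 ≤ L`, `4 ∣ L`), `Δ_d = pairField dWaveFormFactor L`,
`S^±_tot = Σ_R onSite R (spinRaise/spinLower 1)` on the `M × M` plaquette torus, `Λ(φ) = Re⟨φ, S⁺_tot S⁻_tot φ⟩`
(the route's order parameter), `c = c(U) = (plaquettePairCouplings U).c`.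

The open stub `stub_dressHalfFilled` asks that the half-filled planar order `Λ ≥ c(Δ) M⁴` of the XXZ gas survive the
`O(t'³)` Schrieffer–Wolff remainder and be SEEN BY `Δ_d` "through `c(U)² > 0`". This file proves the algebraic core
of that last step, exactly and for every state — the zeroth-order (`t' = 0`) dressing inequality:

* `re_normSq_compression_le` — compression by an isometry does not increase the norm:
  `Φᴴ Φ = 1 ⇒ ‖Φᴴ v‖² ≤ ‖v‖²`;
* `re_normSq_pullback_le` — for any operator `A` with pull-back `Φᴴ A Φ = B`: `‖B φ‖² ≤ ⟨Φφ, Aᴴ A Φφ⟩`;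
* `lowerRaise_form_eq_raiseLower_form` — on the sector `S^z_tot = 0`: `⟨φ, S⁻_tot S⁺_tot φ⟩ = ⟨φ, S⁺_tot S⁻_tot φ⟩`;
* `pairField_order_ge_of_pullback` — if `Φᴴ Φ = 1` and `Φᴴ Δ_d Φ = c • S⁺_tot` (clauses (a), (e) of the dictionary)
  then for every `φ` with `S^z_tot φ = 0`: **`c² · Λ(φ) ≤ Re⟨Φφ, Δ_d† Δ_d Φφ⟩`**;
* `dictionary_groundState_order_ge` — under `PlaquetteDictionary U`: for `L = 2M ≥ 8`, `4 ∣ L`, every nonzero `φ` of the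
  half-filled boson sector `S^z_tot = 0` is carried by `Φ` to a ground state of the intra-plaquette Hamiltonian
  `H_in = hamiltonian G_intra 1 U` in the electron sector `(2⌊(1 - 1/4)L²/2⌋, S^z = 0)` — the sector of the anchor
  `AnchorAt U (1/4)` — whose `d`-wave order is at least `c(U)² Λ(φ)` (`quarter doping = boson half filling`,
  clauses (b), (c)). In particular the t' = 0 problem has, for every XXZ sector state `φ`, a sector ground state with
  pair-field order `≥ c(U)² Λ(φ)`;
* `exists_unit_sectorGroundState_xxz` — a normalised `S^z_tot = 0` sector ground state of `H_M(Δ)` exists (every real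
  `Δ`, even `M ≥ 2`); `ΔEff_mem_Ioc_of_plaquetteData` — (W1) puts `Δ_eff(U)` in `(-1, 0]`;
* `anchor_shadow_zero_hopping` — **the `t' = 0` shadow of `AnchorAt U (1/4)`**: `PlaquetteData U`, `PlaquetteDictionary U`
  and `HalfFilledOrder` (instantiated at `Δ_eff(U)`) give `c = c(U)² c(Δ_eff)/16 > 0` and `L₀` such that for all
  `L ≥ L₀`, `4 ∣ L`, the quarter-doped sector of `H_in` has a normalised ground state (the dressed XXZ ground state
  `Φ φ_{L/2}`) with `c·L⁴ ≤ Re⟨Δ_d† Δ_d⟩`.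

HONEST LABEL: this is the `t' = 0` shadow of the dressing only (there ALL of `Φ(sector)` is ground space, so the
anchor's "every ground state" form is false at `t' = 0` and true order needs `t' > 0`); the load-bearing content of
stub 3 — survival of the order under the extensive SW remainder uniformly in `L` — is untouched. No crux and no summit
statement is proved. Sources: W.-F. Tsai, S. A. Kivelson, PRB 73 (2006) 214510, App. A [TsaiKivelson2006];
E. Altman, A. Auerbach, PRB 65 (2002) 104508 §II.D; H. Tasaki, *Physics and Mathematics of Quantum Many-Body
Systems* (2020) §2.4, App. A.3 (the `su(2)` relations). No definition and no named fact is introduced; sorry-free.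
-/

noncomputable section

-- `dupNamespace`: the summit and the problem are both named `HubbardSuperconductivity` (layout D-0022)
set_option linter.dupNamespace false

namespace Summit.HubbardSuperconductivity.HubbardSuperconductivity.Theorems.AnisotropyChord.DressZero

open Matrix Finset Literature.MathematicalPhysics.QuantumLattice Literature.Probability.LatticeModels
open scoped ComplexOrder
open Summit.HubbardSuperconductivity.HubbardSuperconductivity.Theorems.LevyLogBootstrap (PlaquetteData PlaquetteDictionary)
open Summit.HubbardSuperconductivity.HubbardSuperconductivity.Theses.AnisotropyChord (HalfFilledOrder)

/-! ### Compression by an isometry -/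

section Compression

variable {m n : Type*} [Fintype m] [Fintype n] [DecidableEq n]

/-- **Compression by an isometry does not increase the norm**: if `Φᴴ Φ = 1` then `‖Φᴴ v‖² ≤ ‖v‖²` (real parts of
the self inner products). Proof: `0 ≤ ‖v - Φ Φᴴ v‖² = ‖v‖² - ‖Φᴴ v‖²`. [folklore] -/
theorem re_normSq_compression_le (Φ : Matrix m n ℂ) (hΦ : Φᴴ * Φ = 1) (v : m → ℂ) :
    (star (Φᴴ *ᵥ v) ⬝ᵥ (Φᴴ *ᵥ v)).re ≤ (star v ⬝ᵥ v).re := by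
  -- the three cross terms all equal `q = ‖Φᴴ v‖²`
  have h1 : star v ⬝ᵥ (Φ *ᵥ (Φᴴ *ᵥ v)) = star (Φᴴ *ᵥ v) ⬝ᵥ (Φᴴ *ᵥ v) := by
    rw [star_mulVec, ← dotProduct_mulVec, conjTranspose_conjTranspose]
  have h2 : star (Φ *ᵥ (Φᴴ *ᵥ v)) ⬝ᵥ v = star (Φᴴ *ᵥ v) ⬝ᵥ (Φᴴ *ᵥ v) := by
    rw [star_mulVec, ← dotProduct_mulVec]
  have h3 : star (Φ *ᵥ (Φᴴ *ᵥ v)) ⬝ᵥ (Φ *ᵥ (Φᴴ *ᵥ v)) = star (Φᴴ *ᵥ v) ⬝ᵥ (Φᴴ *ᵥ v) := by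
    rw [star_mulVec, ← dotProduct_mulVec, mulVec_mulVec, hΦ, one_mulVec]
  have hexp : star (v - Φ *ᵥ (Φᴴ *ᵥ v)) ⬝ᵥ (v - Φ *ᵥ (Φᴴ *ᵥ v)) =
      star v ⬝ᵥ v - star (Φᴴ *ᵥ v) ⬝ᵥ (Φᴴ *ᵥ v) := by
    rw [star_sub, sub_dotProduct, dotProduct_sub, dotProduct_sub, h1, h2, h3]
    ring
  have h0 : 0 ≤ (star (v - Φ *ᵥ (Φᴴ *ᵥ v)) ⬝ᵥ (v - Φ *ᵥ (Φᴴ *ᵥ v))).re :=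
    (Complex.nonneg_iff.mp (dotProduct_star_self_nonneg _)).1
  rw [hexp, Complex.sub_re] at h0
  linarith

/-- **Pull-back inequality.** If `Φᴴ Φ = 1` and `Φᴴ A Φ = B`, then for every `φ`:
`‖B φ‖² ≤ ⟨Φ φ, Aᴴ A Φ φ⟩ = ‖A Φ φ‖²` — the pulled-back operator sees at most the order of `A` in the dictionary
state. [folklore] -/
theorem re_normSq_pullback_le (Φ : Matrix m n ℂ) (hΦ : Φᴴ * Φ = 1) (A : Matrix m m ℂ) (B : Matrix n n ℂ)
    (hAB : Φᴴ * A * Φ = B) (φ : n → ℂ) :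
    (star (B *ᵥ φ) ⬝ᵥ (B *ᵥ φ)).re ≤ (star (Φ *ᵥ φ) ⬝ᵥ ((Aᴴ * A) *ᵥ (Φ *ᵥ φ))).re := by
  have hB : B *ᵥ φ = Φᴴ *ᵥ (A *ᵥ (Φ *ᵥ φ)) := by
    rw [← hAB, mulVec_mulVec, mulVec_mulVec]
  have hA : star (A *ᵥ (Φ *ᵥ φ)) ⬝ᵥ (A *ᵥ (Φ *ᵥ φ)) =
      star (Φ *ᵥ φ) ⬝ᵥ ((Aᴴ * A) *ᵥ (Φ *ᵥ φ)) := by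
    rw [star_mulVec, ← dotProduct_mulVec, mulVec_mulVec]
  rw [hB, ← hA]
  exact re_normSq_compression_le Φ hΦ _

end Compression

/-! ### The `su(2)` bookkeeping on the sector `S^z_tot = 0` -/

section Spin

variable {Λ : Type*} [Fintype Λ] [DecidableEq Λ]

/-- On the sector `S^z_tot = 0`: `⟨φ, S⁻_tot S⁺_tot φ⟩ = ⟨φ, S⁺_tot S⁻_tot φ⟩` (`S⁺S⁻ = S⁻S⁺ + 2S^z_tot` and
`S^z_tot φ = 0`). Tasaki (2020) §2.4. [folklore] -/
theorem lowerRaise_form_eq_raiseLower_form {φ : TensorIndex Λ 2 → ℂ} (hφ : φ ∈ spinZSector (Λ := Λ) 1 0) :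
    star φ ⬝ᵥ ((lowerOn 1 Finset.univ * raiseOn 1 Finset.univ) *ᵥ φ) =
      star φ ⬝ᵥ ((raiseOn 1 Finset.univ * lowerOn 1 Finset.univ) *ᵥ φ) := by
  have h := isSu2Triple_on 1 (Finset.univ : Finset Λ)
  have hZ : zOn 1 Finset.univ *ᵥ φ = 0 := by
    rw [(mem_spinZSector_iff_mulVec 1 0 φ).1 hφ]; simp
  rw [h.PM, add_mulVec, add_mulVec, hZ, add_zero, add_zero]

/-- `‖S⁺_tot φ‖² = ⟨φ, S⁻_tot S⁺_tot φ⟩`. [folklore] -/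
theorem star_raise_dotProduct_raise (φ : TensorIndex Λ 2 → ℂ) :
    star (raiseOn 1 Finset.univ *ᵥ φ) ⬝ᵥ (raiseOn 1 Finset.univ *ᵥ φ) =
      star φ ⬝ᵥ ((lowerOn 1 Finset.univ * raiseOn 1 Finset.univ) *ᵥ φ) := by
  rw [(isSu2Triple_on 1 (Finset.univ : Finset Λ)).star_P_mulVec_dotProduct, mulVec_mulVec]

end Spin

/-! ### The zeroth-order dressing inequality -/

section Dressing

variable {m : Type*} [Fintype m] {M : ℕ} [NeZero M]

/-- **Zeroth-order dressing inequality.** Let `Φ` be an isometry from the spin-`½` space of the `M × M` torus into any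
electron space (`Φᴴ Φ = 1`) and `A` an operator whose pull-back is `c` times the total raising operator,
`Φᴴ A Φ = c • S⁺_tot` (for the dictionary: `A = Δ_d`, clause (e), `c = c(U)`). Then for every `φ` of the sector
`S^z_tot = 0`: `c² · Re⟨φ, S⁺_tot S⁻_tot φ⟩ ≤ Re⟨Φφ, Aᴴ A Φφ⟩` — the planar order parameter of `φ` is seen by `A` in
the dressed state `Φφ` with weight `c²` (compression by the isometry, `‖S⁺φ‖² = ⟨φ,S⁻S⁺φ⟩ = ⟨φ,S⁺S⁻φ⟩` on the
sector). Tsai–Kivelson (2006) App. A; Altman–Auerbach (2002) §II.D. [folklore] -/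
theorem order_ge_of_pullback (Φ : Matrix m (TensorIndex (TorusSite 2 M) 2) ℂ) (hΦ : Φᴴ * Φ = 1)
    (A : Matrix m m ℂ) (c : ℝ)
    (hA : Φᴴ * A * Φ = ((c : ℝ) : ℂ) • ∑ R : TorusSite 2 M, onSite R (spinRaise 1))
    {φ : TensorIndex (TorusSite 2 M) 2 → ℂ} (hφ : φ ∈ spinZSector (Λ := TorusSite 2 M) 1 0) :
    c ^ 2 * (star φ ⬝ᵥ Matrix.mulVec ((∑ x : TorusSite 2 M, onSite x (spinRaise 1)) *
        (∑ y : TorusSite 2 M, onSite y (spinLower 1))) φ).re ≤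
      (star (Φ *ᵥ φ) ⬝ᵥ ((Aᴴ * A) *ᵥ (Φ *ᵥ φ))).re := by
  have hPL : (raiseOn 1 (Finset.univ : Finset (TorusSite 2 M)) * lowerOn 1 Finset.univ) =
      ((∑ x : TorusSite 2 M, onSite x (spinRaise 1)) *
        (∑ y : TorusSite 2 M, onSite y (spinLower 1))) := rfl
  have hP : (raiseOn 1 (Finset.univ : Finset (TorusSite 2 M))) =
      ∑ x : TorusSite 2 M, onSite x (spinRaise 1) := rfl
  have h := re_normSq_pullback_le Φ hΦ A _ hA φ
  -- `‖c S⁺φ‖² = c² ⟨φ, S⁻S⁺φ⟩ = c² ⟨φ, S⁺S⁻φ⟩`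
  have hB : star ((((c : ℝ) : ℂ) • ∑ R : TorusSite 2 M, onSite R (spinRaise 1)) *ᵥ φ) ⬝ᵥ
      ((((c : ℝ) : ℂ) • ∑ R : TorusSite 2 M, onSite R (spinRaise 1)) *ᵥ φ) =
      ((c : ℝ) : ℂ) ^ 2 * (star φ ⬝ᵥ Matrix.mulVec ((∑ x : TorusSite 2 M, onSite x (spinRaise 1)) *
        (∑ y : TorusSite 2 M, onSite y (spinLower 1))) φ) := by
    rw [← hPL, ← hP, smul_mulVec, star_smul, smul_dotProduct, dotProduct_smul, star_raise_dotProduct_raise,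
      lowerRaise_form_eq_raiseLower_form hφ, smul_eq_mul, smul_eq_mul, Complex.star_def, Complex.conj_ofReal]
    ring
  rw [hB, ← Complex.ofReal_pow, Complex.re_ofReal_mul] at h
  exact h

end Dressing

/-! ### Under the dictionary: quarter doping is boson half filling, and the order bound at `t' = 0` -/

/-- The quarter-doping electron count for `L = 2M`, `M = 2k`: `2⌊(1 - 1/4)L²/2⌋ = L² - 2·(M²/2)` with the boson
number `M²/2 = 2k²` a natural number; `(M²/2 : ℝ) - M²/2 = 0` is the sector `S^z_tot = 0`. [bookkeeping] -/
theorem quarterDoping_count (k : ℕ) :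
    2 * ⌊(1 - 1/4 : ℝ) * ((2 * (2 * k) : ℕ) : ℝ) ^ 2 / 2⌋₊ = (2 * (2 * k)) ^ 2 - 2 * (2 * k ^ 2) ∧
      2 * k ^ 2 ≤ (2 * k) ^ 2 ∧ ((2 * k ^ 2 : ℕ) : ℝ) - ((2 * k : ℕ) : ℝ) ^ 2 / 2 = 0 := by
  refine ⟨?_, ?_, ?_⟩
  · have h : (1 - 1/4 : ℝ) * ((2 * (2 * k) : ℕ) : ℝ) ^ 2 / 2 = ((6 * k ^ 2 : ℕ) : ℝ) := by
      push_cast; ring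
    rw [h, Nat.floor_natCast]
    have : (2 * (2 * k)) ^ 2 = 16 * k ^ 2 := by ring
    omega
  · nlinarith
  · push_cast; ring

set_option linter.style.longLine false in
/-- **The dictionary's ground states at quarter doping and their order, `t' = 0`.** Under `PlaquetteDictionary U`:
for `L = 2M`, `8 ≤ L`, `4 ∣ L` there is an isometry `Φ` such that for every nonzero `φ` of the half-filled boson
sector `S^z_tot = 0` of the `M × M` torus, `Φφ` is a ground state of the intra-plaquette Hamiltonian
`H_in = hamiltonian G_intra 1 U` in the electron sector `(2⌊(1 - 1/4)L²/2⌋, S^z = 0)` — the sector of the anchor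
`AnchorAt U (1/4)` at `t' = 0` — and its `d`-wave pair-field order is at least `c(U)²` times the planar order of
`φ`: `c(U)² Re⟨φ, S⁺_tot S⁻_tot φ⟩ ≤ Re expect(Δ_d† Δ_d)(Φφ)`. (Clauses (a), (b), (c), (e) of the dictionary;
the second-order clause (d) is not used.) Tsai–Kivelson (2006) App. A. [folklore] -/
theorem dictionary_groundState_order_ge {U : ℝ} (hD : PlaquetteDictionary U) (L M : ℕ) [NeZero L] [NeZero M]
    (hLM : L = 2 * M) (h8 : 8 ≤ L) (h4 : 4 ∣ L) :
    ∃ Φ : Matrix (Finset (Orb (FermionTorus 2 L))) (TensorIndex (TorusSite 2 M) 2) ℂ,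
      Φᴴ * Φ = 1 ∧
      ∀ φ : TensorIndex (TorusSite 2 M) 2 → ℂ, φ ∈ spinZSector (Λ := TorusSite 2 M) 1 0 → φ ≠ 0 →
        IsGroundStateInSector
            (hamiltonian ((fermionTorusGraph 2 L) \ SimpleGraph.comap
              (fun x : FermionTorus 2 L => fun i : Fin 2 => ((ofLex x) i : ℕ) / 2) ⊤) 1 U)
            (2 * ⌊(1 - 1/4 : ℝ) * (L : ℝ) ^ 2 / 2⌋₊) 0 (Φ *ᵥ φ) ∧
          (plaquettePairCouplings U).c ^ 2 *
              (star φ ⬝ᵥ Matrix.mulVec ((∑ x : TorusSite 2 M, onSite x (spinRaise 1)) *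
                (∑ y : TorusSite 2 M, onSite y (spinLower 1))) φ).re ≤
            (expect ((pairField dWaveFormFactor L)ᴴ * pairField dWaveFormFactor L) (Φ *ᵥ φ)).re := by
  obtain ⟨Φ, hiso, hsec, hexh, -, hpf⟩ := hD L M hLM h8 h4
  refine ⟨Φ, hiso, fun φ hφ hφ0 => ⟨?_, ?_⟩⟩
  · -- `M = 2k`
    obtain ⟨j, hj⟩ := h4
    have hM : M = 2 * j := by omega
    obtain ⟨hcount, hle, hsector⟩ := quarterDoping_count j
    have hL : L = 2 * (2 * j) := by omega
    subst hL
    subst hM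
    rw [hcount]
    have hφ' : φ ∈ spinZSector (Λ := TorusSite 2 (2 * j)) 1 (((2 * j ^ 2 : ℕ) : ℝ) - ((2 * j : ℕ) : ℝ) ^ 2 / 2) := by
      rw [hsector]; exact hφ
    obtain ⟨hmem, heig⟩ := hsec (2 * j ^ 2) hle φ hφ'
    obtain ⟨hmin, -⟩ := hexh (2 * j ^ 2) hle
    refine ⟨hmem, ?_, ?_⟩
    · -- `Φφ ≠ 0` since `Φ` is an isometry
      intro h0
      apply hφ0
      have h1 : star (Φ *ᵥ φ) ⬝ᵥ (Φ *ᵥ φ) = star φ ⬝ᵥ φ := by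
        rw [star_mulVec, ← dotProduct_mulVec, mulVec_mulVec, hiso, one_mulVec]
      rw [h0, dotProduct_zero] at h1
      exact dotProduct_star_self_eq_zero.1 h1.symm
    · rw [hmin]; exact heig
  · exact order_ge_of_pullback Φ hiso _ _ hpf hφ

/-! ### With `HalfFilledOrder`: the `t' = 0` shadow of the anchor at quarter doping -/

/-- A normalised `S^z_tot = 0` sector ground state of `H_M(Δ) = xxzHamiltonian 1 (torusGraph 2 M) (-1) Δ` exists for
every real `Δ` and every even `M ≠ 0` (the sector is non-trivial — it contains the global ground state of the hard-core
gas, `HardCoreBoson.exists_groundState_totalSpin_eq_zero` — and `H_M(Δ)` is Hermitian and conserves `S^z_tot`,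
`XXZKT.exists_eigenvector_lowestEnergyInSector`). Tasaki (2020) §2.2. [folklore] -/
theorem exists_unit_sectorGroundState_xxz (M : ℕ) [NeZero M] (hE : Even M) (Δ : ℝ) :
    ∃ ψ : TensorIndex (TorusSite 2 M) 2 → ℂ,
      ψ ∈ spinZSector (Λ := TorusSite 2 M) 1 0 ∧ star ψ ⬝ᵥ ψ = 1 ∧
        xxzHamiltonian 1 (torusGraph 2 M) (-1) Δ *ᵥ ψ =
          ((lowestEnergyInSector 1 (xxzHamiltonian 1 (torusGraph 2 M) (-1) Δ) 0 : ℝ) : ℂ) • ψ := by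
  -- the sector is non-trivial: it contains the global ground state of the hard-core gas (even torus)
  obtain ⟨ψ₀, hψ₀0, -, hS⟩ := HardCoreBoson.exists_groundState_totalSpin_eq_zero (d := 2) (L := M) two_pos hE 0
  have hmem₀ : ψ₀ ∈ spinZSector (Λ := TorusSite 2 M) 1 0 := by
    rw [spinZSector, Module.End.mem_eigenspace_iff, Matrix.toLin'_apply, hS, Complex.ofReal_zero, zero_smul]
  have hK : spinZSector (Λ := TorusSite 2 M) 1 0 ≠ ⊥ :=
    (Submodule.ne_bot_iff _).2 ⟨ψ₀, hmem₀, hψ₀0⟩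
  exact XXZKT.exists_eigenvector_lowestEnergyInSector (xxzHamiltonian_isHermitian 1 (torusGraph 2 M) (-1) Δ)
    (HardCoreBoson.commute_xxzHamiltonian_totalSpin_two 1 (torusGraph 2 M) (-1) Δ) hK

/-- The lock-in anisotropy of the plaquette data lies in the easy-plane interval: (W1) `0 < J`, `0 ≤ V < 2J` give
`Δ_eff = -V/(2J) ∈ (-1, 0]` (the skeleton's `ΔEff_mem_Ioc`, restated over the `Theorems`-side copy of
`PlaquetteData`). [bookkeeping] -/
theorem ΔEff_mem_Ioc_of_plaquetteData {U : ℝ} (h : PlaquetteData U) :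
    (plaquettePairCouplings U).ΔEff ∈ Set.Ioc (-1:ℝ) 0 := by
  obtain ⟨⟨hJ, hV0, hV⟩, -⟩ := h
  rw [plaquettePairCouplings_ΔEff]
  have h2J : 0 < 2 * (plaquettePairCouplings U).J := by positivity
  constructor
  · rw [neg_div, neg_lt_neg_iff, div_lt_one h2J]
    exact hV
  · rw [neg_div, neg_nonpos]
    exact div_nonneg hV0 h2J.le

set_option linter.style.longLine false in
/-- **The `t' = 0` shadow of the anchor `AnchorAt U (1/4)`.** At a coupling `U` carrying the plaquette data and the
dictionary, the half-filled planar order `HalfFilledOrder` — instantiated at the lock-in point `Δ_eff(U) ∈ (-1, 0]`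
— yields `c > 0` and `L₀` such that for every `L ≥ L₀` with `4 ∣ L` the intra-plaquette Hamiltonian
`H_in = hamiltonian G_intra 1 U` (the anchor's Hamiltonian at `t' = 0`) has a normalised ground state in the quarter-doped
sector `(2⌊(1 - 1/4)L²/2⌋, S^z = 0)` with `d`-wave pair-field order `c·L⁴ ≤ Re⟨Δ_d† Δ_d⟩` — namely the dressed XXZ
ground state `Φ φ_M`, `M = L/2`, with `c = c(U)² c(Δ_eff)/16`. This is NOT the anchor (which quantifies over EVERY
sector ground state at `t' ∈ (0, t₀)`; at `t' = 0` the sector ground space is all of `Φ(S^z_tot = 0)` and most of it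
carries no order): it is the statement the dressing must upgrade by controlling the `O(t'²)` selection and the `O(t'³)`
remainder uniformly in `L`. Tsai–Kivelson (2006) App. A; Yao–Tsai–Kivelson (2007) eq. (2). [folklore] -/
theorem anchor_shadow_zero_hopping {U : ℝ} (hPD : PlaquetteData U) (hD : PlaquetteDictionary U)
    (hH : HalfFilledOrder) :
    ∃ c : ℝ, 0 < c ∧ ∃ L₀ : ℕ, ∀ (L : ℕ) [NeZero L], L₀ ≤ L → 4 ∣ L →
      ∃ ψ : Fock (Orb (FermionTorus 2 L)), star ψ ⬝ᵥ ψ = 1 ∧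
        IsGroundStateInSector
            (hamiltonian ((fermionTorusGraph 2 L) \ SimpleGraph.comap
              (fun x : FermionTorus 2 L => fun i : Fin 2 => ((ofLex x) i : ℕ) / 2) ⊤) 1 U)
            (2 * ⌊(1 - 1/4 : ℝ) * (L : ℝ) ^ 2 / 2⌋₊) 0 ψ ∧
        c * (L : ℝ) ^ 4 ≤ (expect ((pairField dWaveFormFactor L)ᴴ * pairField dWaveFormFactor L) ψ).re := by
  obtain ⟨cΔ, hcΔ, M₀, hM⟩ := hH _ (ΔEff_mem_Ioc_of_plaquetteData hPD)
  have hc : 0 < (plaquettePairCouplings U).c := hPD.2.1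
  refine ⟨(plaquettePairCouplings U).c ^ 2 * cΔ / 16, by positivity, max 8 (2 * M₀), ?_⟩
  intro L _ hL h4
  have h8 : 8 ≤ L := le_trans (le_max_left _ _) hL
  have hM₀L : 2 * M₀ ≤ L := le_trans (le_max_right _ _) hL
  obtain ⟨j, hj⟩ := h4
  -- `M = L/2 = 2j`
  haveI : NeZero (2 * j) := ⟨by omega⟩
  have hLM : L = 2 * (2 * j) := by omega
  have hE : Even (2 * j) := ⟨j, two_mul j⟩
  have hM₀ : M₀ ≤ 2 * j := by omega
  obtain ⟨φ, hmem, hφ1, heig⟩ := exists_unit_sectorGroundState_xxz (2 * j) hE (plaquettePairCouplings U).ΔEff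
  have hΛ := hM (2 * j) hE hM₀ φ hmem hφ1 heig
  have hφ0 : φ ≠ 0 := by
    intro h
    rw [h, dotProduct_zero] at hφ1
    exact zero_ne_one hφ1
  obtain ⟨Φ, hiso, hall⟩ := dictionary_groundState_order_ge hD L (2 * j) hLM h8 ⟨j, hj⟩
  obtain ⟨hgs, hord⟩ := hall φ hmem hφ0
  refine ⟨Φ *ᵥ φ, ?_, hgs, ?_⟩
  · rw [star_mulVec, ← dotProduct_mulVec, mulVec_mulVec, hiso, one_mulVec, hφ1]
  · have hL4 : (L : ℝ) ^ 4 = 16 * ((2 * j : ℕ) : ℝ) ^ 4 := by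
      rw [hLM]; push_cast; ring
    have hc2 : 0 ≤ (plaquettePairCouplings U).c ^ 2 := sq_nonneg _
    calc (plaquettePairCouplings U).c ^ 2 * cΔ / 16 * (L : ℝ) ^ 4
        = (plaquettePairCouplings U).c ^ 2 * (cΔ * ((2 * j : ℕ) : ℝ) ^ 4) := by rw [hL4]; ring
      _ ≤ (plaquettePairCouplings U).c ^ 2 *
            (star φ ⬝ᵥ Matrix.mulVec ((∑ x : TorusSite 2 (2 * j), onSite x (spinRaise 1)) *
              (∑ y : TorusSite 2 (2 * j), onSite y (spinLower 1))) φ).re :=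
          mul_le_mul_of_nonneg_left hΛ hc2
      _ ≤ _ := hord

end Summit.HubbardSuperconductivity.HubbardSuperconductivity.Theorems.AnisotropyChord.DressZero

end
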